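import Literature.AnabelianGeometry.AbsoluteAnabelian.DiagramMorphisms
import Mathlib.CategoryTheory.Equivalence

/-!
# The diagram of categories of [AbsTopIII] Cor 3.6 / 3.7 / 4.5 (Def 3.1 (iii), (vi) as input data)

Statements-first typing (D-0014) of S. Mochizuki, *Topics in absolute anabelian geometry III*, §3–§4:
the diagram `𝒟` of Cor 3.6 p.78 (six rows: the `log`-chain of copies of `𝒳 = 𝒞^{MLF-sB}_T`, the nexus
`□`, `𝒩`, `ℰ = 𝒯𝒢_sB`, `Anab`, `ℰ`), its bi-anabelian variant `𝒟†` of Cor 3.7 p.86 and its archimedean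
variant of Cor 4.5 p.107, built HONESTLY as `DiagramOfCategories` (file `DiagramsOfCategories`) on an
explicit quiver `LFVertex`, over ABSTRACT categorical input data (`LogFrobeniusData`: the categories and
the functors `log`, `λ^×`, `λ^{×pf}`, `ι_log`, `ι_×`, `κ_An`, `φ_An`, `η_An` named in Def 3.1 (iii), (iv),
(vi) and Prop 3.2 (v) / Def 4.1 (iii)–(v), Prop 4.2 (ii)).  The categories `𝒞^MLF_T`, `𝒯𝒢_sB`, `Anab`
themselves (Def 3.1 (iii), (vi): objects = MLF-Galois pairs of `MLFGaloisPairs.lean` / profinite groups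
of strictly Belyi type / pairs `(Π, Π ↷ {k̄^× ↪ lim H¹(J, μ_Ẑ(Π))})` "constructed via the group-theoretic
algorithms of Corollary 1.10") are NOT instantiated here: Cor 1.10 is seat abc-iut-L4-t1's and
"strictly Belyi type" is scheme-theoretic (TODO-merge abc-iut-L4-t1); the corollaries are typed as
`Prop`-valued structures on the data, field by printed item (i)–(v).  Bib key `MochizukiAbsTopIII2015`;
locators = kurims manuscript pages (`paper:url-5493eb38cbb7`).

This file: the oriented graph `Γ⃗_𝒟` (`LFVertex`), the input data (`LogFrobeniusData`), the diagram
`𝒟` and its truncations `𝒟_{≤n}`, and the presentation of `𝒟_{≤3}` as `𝒟_{≤2}` extended by the observation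
vertex `𝒩` (used by Cor 3.6 (iii), (iv)).  The corollaries are in `LogFrobeniusCompatibility.lean`.
-/

namespace Literature.AnabelianGeometry.AbsoluteAnabelian

open _root_.CategoryTheory _root_.Quiver

universe w u

/-! ### The oriented graph of Cor 3.6 -/

/-- Vertices of the oriented graph `Γ⃗_𝒟` of Cor 3.6: the first row `… 𝒳 → 𝒳 → …` indexed by
`⋎ ∈ L ≅ ℤ`, the nexus `□` (second row), and the vertices of rows 3–6 carrying `𝒩`, `ℰ`, `Anab` (resp.
the "second factor"/`LinHol` core in Cor 3.7 / 4.5), `ℰ`.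
[cite: MochizukiAbsTopIII2015, Corollary 3.6 p.78] -/
inductive LFVertex : Type
  | row1 (n : ℤ) | nexus | third | fourth | fifth | sixth
  deriving DecidableEq

namespace LFVertex

/-- The row of a vertex (`1, …, 6`). [cite: MochizukiAbsTopIII2015, Corollary 3.6 p.79] -/
def row : LFVertex → ℕ
  | row1 _ => 1 | nexus => 2 | third => 3 | fourth => 4 | fifth => 5 | sixth => 6

/-- Edges of `Γ⃗_𝒟`: `log : ⋎+1 → ⋎` in the first row ("`k^×_⋎` is obtained by applying `𝔩𝔬𝔤` to
`k^×_{⋎+1}`", Rmk 3.6.1), `id_⋎ : ⋎ → □`, two edges `λ^×, λ^{×pf} : □ → (row 3)`, and one edge each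
`(3) → (4) → (5) → (6)`.
[cite: MochizukiAbsTopIII2015, Corollary 3.6 p.78] -/
def Hom : LFVertex → LFVertex → Type w
  | row1 a, row1 b => ULift (PLift (a = b + 1))
  | row1 _, nexus => PUnit
  | nexus, third => ULift Bool
  | third, fourth => PUnit
  | fourth, fifth => PUnit
  | fifth, sixth => PUnit
  | _, _ => PEmpty

/-- `Γ⃗_𝒟` as a quiver (edges in any universe `w`, to match the categories placed on it).
[cite: MochizukiAbsTopIII2015, Corollary 3.6 p.78] -/
instance quiver : Quiver.{w} LFVertex := ⟨LFVertex.Hom.{w}⟩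

/-- The edge `log : (⋎+1) → ⋎`. [cite: MochizukiAbsTopIII2015, Corollary 3.6 p.78] -/
def logEdge (n : ℤ) : (row1 (n + 1) : LFVertex) ⟶ row1 n := ULift.up (PLift.up rfl)

/-- The edge `id_⋎ : ⋎ → □`. [cite: MochizukiAbsTopIII2015, Corollary 3.6 p.78] -/
def idEdge (n : ℤ) : (row1 n : LFVertex) ⟶ nexus := PUnit.unit

/-- The edge `λ^× : □ → 𝒩`. [cite: MochizukiAbsTopIII2015, Corollary 3.6 p.78] -/
def lamTimesEdge : (nexus : LFVertex) ⟶ third := ULift.up true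

/-- The edge `λ^{×pf} : □ → 𝒩` (resp. `λ^∼` in Cor 4.5). [cite: MochizukiAbsTopIII2015, Corollary 3.6 p.78] -/
def lamPfEdge : (nexus : LFVertex) ⟶ third := ULift.up false

end LFVertex

/-! ### The abstract input data and the diagram `𝒟` -/

/-- **Input data of Cor 3.6 / 4.5** (Def 3.1 (iii), (iv), (vi), Prop 3.2 (v); Def 4.1 (iii)–(v), Prop
4.2 (ii)): the categories `𝒳` (`𝒞^{MLF-sB}_T`, resp. `𝒞^hol_T`), `𝒩`, `ℰ` (`𝒯𝒢_sB`, resp. `EA`), `𝒜`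
(`Anab`, resp. `LinHol`); the log-Frobenius functor `𝔩𝔬𝔤 : 𝒳 ⥤ 𝒳` "isomorphic to the identity functor";
`λ^×, λ^{×pf} : 𝒳 ⥤ 𝒩` with `ι_log : λ^× ∘ 𝔩𝔬𝔤 → λ^{×pf}` and `ι_× : λ^× → λ^{×pf}` (Cor 4.5: `λ^×, λ^∼` and
`ι_× : λ^∼ → λ^×` — the direction flag `timesToPf`); the projections `𝒳 → ℰ`, `𝒩 → ℰ`; the equivalence
`κ : ℰ ⥤ 𝒜` with quasi-inverse the projection `𝒜 ⥤ ℰ`; the "forgetful" functor `φ : 𝒜 ⥤ 𝒳`, an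
equivalence with quasi-inverse `π := (𝒳 → ℰ) ⋙ κ` and `η : φ ∘ π ⥲ id_𝒳`.
[cite: MochizukiAbsTopIII2015, Corollary 3.6 (ii) p.79] -/
structure LogFrobeniusData : Type (u+1) where
  /-- The category on the FIRST row: `𝒳` itself in Cor 3.6 / 4.5, `𝒳 ×_ℰ 𝒳` in Cor 3.7. -/
  X₁ : Type u
  [catX₁ : Category.{u} X₁]
  /-- `𝒳` (at the nexus `□`). -/
  X : Type u
  [catX : Category.{u} X]
  /-- The edges `⋎ → □`: `id_⋎` in Cor 3.6 / 4.5, `pr_⋎` in Cor 3.7. -/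
  toNexus : X₁ ⥤ X
  /-- `𝒩`. -/
  N : Type u
  [catN : Category.{u} N]
  /-- `ℰ`. -/
  E : Type u
  [catE : Category.{u} E]
  /-- `Anab` (resp. `LinHol`). -/
  A : Type u
  [catA : Category.{u} A]
  /-- `𝔩𝔬𝔤` on the first row (`𝔩𝔬𝔤_{T,T}`, resp. `𝔩𝔬𝔤_𝒳 = 𝔩𝔬𝔤 ×_ℰ 𝔩𝔬𝔤`), "isomorphic to the identity
  functor" (Prop 3.2 (v)). -/
  log : X₁ ⥤ X₁
  logIsoId : log ≅ 𝟭 X₁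
  /-- `λ^×`. -/
  lamTimes : X ⥤ N
  /-- `λ^{×pf}` (resp. `λ^∼`). -/
  lamPf : X ⥤ N
  /-- `ι_log,⋎ : λ^× ∘ id_⋎ ∘ 𝔩𝔬𝔤 → λ^{×pf} ∘ id_{⋎+1}` (resp. with `pr_⋎`). -/
  ιlog : (log ⋙ toNexus) ⋙ lamTimes ⟶ toNexus ⋙ lamPf
  /-- `ι_×`: `λ^× → λ^{×pf}` (§3, left summand) or `λ^∼ → λ^×` (§4, right summand: "certain arrows go in
  the opposite direction", Rmk 4.5.2). -/
  ιtimes : (lamTimes ⟶ lamPf) ⊕ (lamPf ⟶ lamTimes)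
  /-- `𝒳 → ℰ` ("the natural projection functor"). -/
  XtoE : X ⥤ E
  /-- `𝒩 → ℰ`. -/
  NtoE : N ⥤ E
  /-- The projections to `ℰ` commute with `λ^×`, `λ^{×pf}` ("the natural projection functor"). -/
  lamTimes_NtoE : lamTimes ⋙ NtoE = XtoE
  lamPf_NtoE : lamPf ⋙ NtoE = XtoE
  /-- `κ_An : ℰ ⥤ Anab` (resp. `κ_LH`). -/
  κ : E ⥤ A
  /-- The projection `Anab ⥤ ℰ`, a quasi-inverse of `κ`. -/
  AtoE : A ⥤ E
  κ_equiv : κ.IsEquivalence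
  κ_inv : κ ⋙ AtoE ≅ 𝟭 E
  /-- `φ_An : Anab ⥤ 𝒳` (resp. `φ_LH`). -/
  φ : A ⥤ X
  φ_equiv : φ.IsEquivalence
  /-- `η_An : φ_An ∘ π_An ⥲ id_𝒳`, `π_An = (𝒳 → ℰ) ⋙ κ_An`. -/
  η : (XtoE ⋙ κ) ⋙ φ ≅ 𝟭 X

attribute [instance] LogFrobeniusData.catX₁ LogFrobeniusData.catX LogFrobeniusData.catN
  LogFrobeniusData.catE LogFrobeniusData.catA

namespace LogFrobeniusData

variable (Δ : LogFrobeniusData.{u})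

/-- The category placed at each vertex of `Γ⃗_𝒟`: `𝒳` on rows 1–2, `𝒩`, `ℰ`, `𝒜`, `ℰ` on rows 3–6.
[cite: MochizukiAbsTopIII2015, Corollary 3.6 p.78] -/
def objAt : LFVertex → Type u
  | .row1 _ => Δ.X₁ | .nexus => Δ.X | .third => Δ.N | .fourth => Δ.E | .fifth => Δ.A | .sixth => Δ.E

/-- The category structure at each vertex. [cite: MochizukiAbsTopIII2015, Corollary 3.6 p.78] -/
instance catAt : (a : LFVertex) → Category.{u} (Δ.objAt a)
  | .row1 _ => Δ.catX₁ | .nexus => Δ.catX | .third => Δ.catN | .fourth => Δ.catE | .fifth => Δ.catA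
  | .sixth => Δ.catE

/-- The functor placed on each edge of `Γ⃗_𝒟`: `𝔩𝔬𝔤` on the first row, `id_⋎` into `□`, `λ^×` / `λ^{×pf}`
into row 3, then `𝒩 → ℰ`, `κ`, `𝒜 → ℰ`. [cite: MochizukiAbsTopIII2015, Corollary 3.6 p.78] -/
def mapAt : ∀ {a b : LFVertex}, (a ⟶ b) → (Δ.objAt a ⥤ Δ.objAt b)
  | .row1 _, .row1 _, _ => Δ.log
  | .row1 _, .nexus, _ => Δ.toNexus
  | .nexus, .third, e => if (ULift.down e : Bool) then Δ.lamTimes else Δ.lamPf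
  | .third, .fourth, _ => Δ.NtoE
  | .fourth, .fifth, _ => Δ.κ
  | .fifth, .sixth, _ => Δ.AtoE
  | .row1 _, .third, e => PEmpty.elim e
  | .row1 _, .fourth, e => PEmpty.elim e
  | .row1 _, .fifth, e => PEmpty.elim e
  | .row1 _, .sixth, e => PEmpty.elim e
  | .nexus, .row1 _, e => PEmpty.elim e
  | .nexus, .nexus, e => PEmpty.elim e
  | .nexus, .fourth, e => PEmpty.elim e
  | .nexus, .fifth, e => PEmpty.elim e
  | .nexus, .sixth, e => PEmpty.elim e
  | .third, .row1 _, e => PEmpty.elim e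
  | .third, .nexus, e => PEmpty.elim e
  | .third, .third, e => PEmpty.elim e
  | .third, .fifth, e => PEmpty.elim e
  | .third, .sixth, e => PEmpty.elim e
  | .fourth, .row1 _, e => PEmpty.elim e
  | .fourth, .nexus, e => PEmpty.elim e
  | .fourth, .third, e => PEmpty.elim e
  | .fourth, .fourth, e => PEmpty.elim e
  | .fourth, .sixth, e => PEmpty.elim e
  | .fifth, .row1 _, e => PEmpty.elim e
  | .fifth, .nexus, e => PEmpty.elim e
  | .fifth, .third, e => PEmpty.elim e
  | .fifth, .fourth, e => PEmpty.elim e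
  | .fifth, .fifth, e => PEmpty.elim e
  | .sixth, .row1 _, e => PEmpty.elim e
  | .sixth, .nexus, e => PEmpty.elim e
  | .sixth, .third, e => PEmpty.elim e
  | .sixth, .fourth, e => PEmpty.elim e
  | .sixth, .fifth, e => PEmpty.elim e
  | .sixth, .sixth, e => PEmpty.elim e

/-- **The diagram of categories `𝒟` of Cor 3.6** (resp. Cor 4.5) on `Γ⃗_𝒟`.
[cite: MochizukiAbsTopIII2015, Corollary 3.6 p.78] -/
def diagram : DiagramOfCategories.{u, u, 0} LFVertex where
  obj := Δ.objAt
  cat := Δ.catAt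
  map e := Δ.mapAt e

/-- `𝒟_{≤n}`: "the subdiagram of categories of `𝒟` determined by the first `n` rows".
[cite: MochizukiAbsTopIII2015, Corollary 3.6 p.79] -/
def sub (n : ℕ) :
    DiagramOfCategories.{u, u, 0} (DiagramOfCategories.SubVertex {a : LFVertex | a.row ≤ n}) :=
  Δ.diagram.restrict {a | a.row ≤ n}

/-- A vertex of `𝒟_{≤n}` from a vertex of `𝒟` and a proof. [folklore] -/
def vx (n : ℕ) (a : LFVertex) (h : a.row ≤ n) :
    DiagramOfCategories.SubVertex {a : LFVertex | a.row ≤ n} := ⟨a, h⟩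

/-! ### The observable shapes used in Cor 3.6 (i)–(iv) -/

/-- Observation edges of the shape "append `𝒩` to `𝒟_{≤2}`": two edges (`λ^×`, `λ^{×pf}`) out of `□`,
none elsewhere. [cite: MochizukiAbsTopIII2015, Corollary 3.6 (iii) p.80] -/
def logObsI : DiagramOfCategories.SubVertex {a : LFVertex | a.row ≤ 2} → Type u
  | ⟨.nexus, _⟩ => ULift Bool
  | ⟨.row1 _, _⟩ => PEmpty
  | ⟨.third, _⟩ => PEmpty
  | ⟨.fourth, _⟩ => PEmpty
  | ⟨.fifth, _⟩ => PEmpty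
  | ⟨.sixth, _⟩ => PEmpty

/-- The shape "append the row-3 vertex `𝒩` to `𝒟_{≤2}` with the two edges `λ^×, λ^{×pf}` from `□`" — the
extended diagram is `𝒟_{≤3}`. [cite: MochizukiAbsTopIII2015, Corollary 3.6 (iii) p.80] -/
def logObsShape : ExtShape.{u} (DiagramOfCategories.SubVertex {a : LFVertex | a.row ≤ 2}) where
  I := logObsI.{u}
  J _ := PEmpty

/-- The extension data: `𝒩` at the observation vertex, `λ^×` (`true`) and `λ^{×pf}` (`false`) on the two
observation edges. [cite: MochizukiAbsTopIII2015, Corollary 3.6 (iii) p.80] -/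
def logObsExt : (Δ.sub 2).ExtData logObsShape.{u} where
  S := Δ.N
  obsMap {a} i := match a, i with
    | ⟨.nexus, _⟩, i => if (ULift.down i : Bool) then Δ.lamTimes else Δ.lamPf
    | ⟨.row1 _, _⟩, i => PEmpty.elim i
    | ⟨.third, _⟩, i => PEmpty.elim i
    | ⟨.fourth, _⟩, i => PEmpty.elim i
    | ⟨.fifth, _⟩, i => PEmpty.elim i
    | ⟨.sixth, _⟩, i => PEmpty.elim i
  telMap j := PEmpty.elim j

/-- `𝒟_{≤3}` presented as the extension of `𝒟_{≤2}` by the observation vertex `𝒩`.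
[cite: MochizukiAbsTopIII2015, Corollary 3.6 (iii) p.80] -/
def sub3 : DiagramOfCategories logObsShape.{u}.Vertex := (Δ.sub 2).extend Δ.logObsExt

/-! ### Corollary 3.6 -/

end LogFrobeniusData

end Literature.AnabelianGeometry.AbsoluteAnabelian
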